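import Literature.NumberTheory.DiophantineGeometry.SUnitAbcBoundsCongruenceNumber
import HarnessLib

/-!
# Murty–Pasten 2013, Theorems 1.1–1.2: the `abc`-triple forms and the asymptotic clause (proofs)

Topic `Literature/NumberTheory/DiophantineGeometry`; companion PROOF file of
`SUnitAbcBoundsCongruenceNumber.lean` (M. R. Murty, H. Pasten, *Modular forms and effective
Diophantine approximation*, J. Number Theory 133 (2013) 3739–3754, Thms 1.1–1.2 [`MurtyPasten2013`]).
Theorems only, no new statement:

* `MurtyPasten.abcTriple_log_lt` — Thm 1.2 for the tree's `IsABCTriple a b c` / `rad a b c`: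
  `log c < 4.8 R log R + 13 R + 25`;
* `MurtyPasten.bakerShapeBound_one_one` (`Literature.Barriers.ABC.BakerShapeBound 1 1`, `κ = 56`) and
  `MurtyPasten.epsShapeBound_one` (`Literature.Barriers.ABC.EpsShapeBound 1`): the exponential shape
  class reached by the modular method in 2013 ("`log max{|A|,|B|,|C|} ≪ rad(ABC)^{1+ε}` is better than
  the first bound obtained by transcendental methods, but it is certainly worse than the subsequent
  improvements", p. 3741) — below the tree's PROVED `EpsShapeBound (2/3)` (Stewart–Yu 1991,
  `Summit.ABC…stewartYu1991_holds`) in exponent, with explicit constants as its merit;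
* `MurtyPasten.sUnit_height_asymptotic_of_abc` — the second display of Thm 1.1
  (`4 P log P + O(P log log P)`) from both parts of Thm 1.2, as in §8 ("for the second part one does
  the same computation").

## References

* [MurtyPasten2013] M. R. Murty, H. Pasten, J. Number Theory 133 (2013) 3739–3754, Thm 1.1, Thm 1.2,
  §8.
-/

noncomputable section

open Height UniqueFactorizationMonoid

namespace Literature.NumberTheory.DiophantineGeometry

namespace MurtyPasten

open VonKanelMatschke

/-- `log log x ≥ 1` for `x ≥ 16` (`log 16 = 4 log 2 > e`). [folklore] -/
private theorem one_le_log_log {x : ℝ} (hx : 16 ≤ x) : 1 ≤ Real.log (Real.log x) := by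
  have h2 := Real.log_two_gt_d9
  have he := Real.exp_one_lt_d9
  have h16 : Real.log 16 = 4 * Real.log 2 := by
    rw [show (16 : ℝ) = 2 ^ 4 by norm_num, Real.log_pow]; norm_num
  have hlog : Real.exp 1 ≤ Real.log x := by
    have : Real.log 16 ≤ Real.log x := Real.log_le_log (by norm_num) hx
    linarith
  calc (1 : ℝ) = Real.log (Real.exp 1) := (Real.log_exp 1).symm
    _ ≤ Real.log (Real.log x) := Real.log_le_log (Real.exp_pos 1) hlog

/-! ### The `abc`-triple forms in the tree's currency (`IsABCTriple`, `rad`, shape classes) -/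

/-- **Thm 1.2 for `abc` triples** (PROVED from the named statement): every coprime positive
`a + b = c` satisfies `log c < 4.8 R log R + 13 R + 25`, `R = rad(abc)`.
[cite: MurtyPasten2013, Thm 1.2 (p. 3741)] -/
theorem abcTriple_log_lt (h : abc_log_max_lt) {a b c : ℕ} (ht : IsABCTriple a b c) :
    Real.log c < 4.8 * (rad a b c : ℝ) * Real.log (rad a b c : ℕ) + 13 * (rad a b c : ℝ) + 25 := by
  obtain ⟨ha, hb, habc, hcop⟩ := ht
  have hc : 0 < c := by omega
  have hg : Int.gcd (Int.gcd (a : ℤ) b : ℤ) c = 1 := by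
    simp [Int.gcd_natCast_natCast, Nat.Coprime.gcd_eq_one hcop]
  have h1 := h a b c (by exact_mod_cast ha.ne') (by exact_mod_cast hb.ne') (by exact_mod_cast hc.ne')
    (by exact_mod_cast habc) hg
  have hmax : (max |(a : ℤ)| (max |(b : ℤ)| |(c : ℤ)|) : ℤ) = c := by
    rw [Nat.abs_cast, Nat.abs_cast, Nat.abs_cast]
    have : (a : ℤ) ≤ c ∧ (b : ℤ) ≤ c :=
      ⟨by exact_mod_cast (by omega : a ≤ c), by exact_mod_cast (by omega : b ≤ c)⟩
    rw [max_eq_right this.2, max_eq_right this.1]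
  have hrad : radical ((a : ℤ) * b * c).natAbs = rad a b c := by
    rw [rad_def, show ((a : ℤ) * b * c) = ((a * b * c : ℕ) : ℤ) by push_cast; ring,
      Int.natAbs_natCast]
  rw [hmax, hrad] at h1
  exact_mod_cast h1

/-- **Thm 1.2 ⟹ the Baker shape `(θ, m) = (1, 1)` with `κ = 56`** (PROVED): `log c ≤ 56 R log R` for
every `abc` triple (`13 R ≤ 26 R log R`, `25 ≤ 25 R log R` as `R ≥ 2`, `log R ≥ ½`) —
`Literature.Barriers.ABC.BakerShapeBound 1 1`, reached here by the modular method ("our bound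
`log max{|A|,|B|,|C|} ≪ rad(ABC)^{1+ε}` is better than the first bound obtained by transcendental
methods [Stewart–Tijdeman], but it is certainly worse than the subsequent improvements", p. 3741).
[cite: MurtyPasten2013, Thm 1.2 and the comparison on p. 3741] -/
theorem bakerShapeBound_one_one (h : abc_log_max_lt) : Literature.Barriers.ABC.BakerShapeBound 1 1 := by
  refine ⟨56, fun a b c ht => ?_⟩
  have h1 := abcTriple_log_lt h ht
  have hR2 : (2 : ℝ) ≤ (rad a b c : ℝ) := by exact_mod_cast ht.two_le_rad
  have hlog : (1 : ℝ) / 2 ≤ Real.log (rad a b c : ℕ) := by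
    have := Real.log_two_gt_d9
    have h2 : Real.log 2 ≤ Real.log (rad a b c : ℕ) := Real.log_le_log (by norm_num) hR2
    linarith
  have hR0 : (0 : ℝ) ≤ (rad a b c : ℝ) := by linarith
  rw [Real.rpow_one, pow_one]
  nlinarith [mul_le_mul_of_nonneg_left hlog hR0, mul_le_mul hR2 hlog (by norm_num) hR0]

/-- **Thm 1.2 ⟹ the `ε`-shape with exponent `1`** (PROVED): for every `ε > 0`,
`log c ≤ (56/ε) · rad(abc)^{1+ε}` for all `abc` triples, i.e. `Literature.Barriers.ABC.EpsShapeBound 1`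
(`= EpsShapeBoundOne`, the tree's rung `A1.M2⁻`, there reached through `p`-adic linear forms): the
modular method's shape "`log max ≪ rad(ABC)^{1+ε}`" (p. 3741). [cite: MurtyPasten2013, Thm 1.2 (p. 3741)] -/
theorem epsShapeBound_one (h : abc_log_max_lt) : Literature.Barriers.ABC.EpsShapeBound 1 := by
  obtain ⟨κ, hκ⟩ := bakerShapeBound_one_one h
  intro ε hε
  refine ⟨κ / ε, 0, fun a b c ht _ => ?_⟩
  have h1 := hκ a b c ht
  rw [Real.rpow_one, pow_one] at h1
  have hR1 : (1 : ℝ) ≤ (rad a b c : ℝ) := Literature.Barriers.ABC.one_le_rad_real a b c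
  have hR0 : (0 : ℝ) < (rad a b c : ℝ) := by linarith
  have hlog : Real.log (rad a b c : ℕ) ≤ (rad a b c : ℝ) ^ ε / ε := Real.log_le_rpow_div hR0.le hε
  have hκ0 : 0 ≤ κ := by
    have hc : (2 : ℝ) ≤ c := by exact_mod_cast ht.two_le
    have hlc : 0 < Real.log c := Real.log_pos (by linarith)
    have hRl : 0 < (rad a b c : ℝ) * Real.log (rad a b c : ℕ) :=
      mul_pos hR0 (Real.log_pos (by exact_mod_cast ht.two_le_rad))
    nlinarith
  calc Real.log c ≤ κ * (rad a b c : ℝ) * Real.log (rad a b c : ℕ) := h1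
    _ ≤ κ * (rad a b c : ℝ) * ((rad a b c : ℝ) ^ ε / ε) :=
        mul_le_mul_of_nonneg_left hlog (mul_nonneg hκ0 hR0.le)
    _ = κ / ε * ((rad a b c : ℝ) ^ (1 : ℝ) * (rad a b c : ℝ) ^ ε) := by rw [Real.rpow_one]; ring
    _ = κ / ε * (rad a b c : ℝ) ^ (1 + ε : ℝ) := by rw [← Real.rpow_add hR0]

/-! ### The asymptotic clause of Thm 1.1 from Thm 1.2 -/

/-- **Thm 1.2 (both parts) ⟹ Thm 1.1, second part** (PROVED): `max{h(U), h(V)} ≤ 4 P log P + O(P log log P)`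
(with `P₀ = 16` and `O`-constant `max(C, 0) + K₀`, `K₀` the explicit bound at the threshold radius):
for the triple `A + B = C` of `exists_abc_of_sUnit`, either `R = rad(ABC)` is above the threshold of
the asymptotic clause of Thm 1.2 (and `R ≤ P`), or the explicit Thm 1.2 bounds `log max` by a
constant. [cite: MurtyPasten2013, Thm 1.1 (second display) and §8 ("For the second part one does the same computation")] -/
theorem sUnit_height_asymptotic_of_abc (hA : abc_log_max_asymptotic) (hE : abc_log_max_lt) :
    sUnit_height_asymptotic := by
  obtain ⟨C, r₀, hC⟩ := hA
  set r₁ : ℝ := max r₀ 16 with hr₁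
  set K₀ : ℝ := 4.8 * r₁ * Real.log r₁ + 13 * r₁ + 25 with hK₀
  have hr₁16 : 16 ≤ r₁ := le_max_right _ _
  have hK₀0 : 0 ≤ K₀ := by
    have : 0 ≤ Real.log r₁ := Real.log_nonneg (by linarith)
    positivity
  refine ⟨max C 0 + K₀, 16, fun S hS hP U V hU hV hUV => ?_⟩
  obtain ⟨A, B, D, hA0, hB0, hD, hABD, hg, hsub, hmax⟩ := exists_abc_of_sUnit hU hV hUV
  have h1' := hC A B D hA0 hB0 hD.ne' hABD hg
  have h2' := hE A B D hA0 hB0 hD.ne' hABD hg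
  have hRP : ((radical (A * B * D).natAbs : ℕ) : ℝ) ≤ (primesProd S : ℝ) := by
    exact_mod_cast radical_le_primesProd hS hsub
  have hR1 : (1 : ℝ) ≤ ((radical (A * B * D).natAbs : ℕ) : ℝ) := by
    exact_mod_cast Nat.radical_pos _
  set P : ℝ := (primesProd S : ℝ) with hPdef
  set R : ℝ := ((radical (A * B * D).natAbs : ℕ) : ℝ) with hRdef
  have hllP : 1 ≤ Real.log (Real.log P) := one_le_log_log hP
  have hlP : 0 ≤ Real.log P := Real.log_nonneg (by linarith)
  have hPlP : 0 ≤ P * Real.log P := mul_nonneg (by linarith) hlP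
  have hPllP : 1 ≤ P * Real.log (Real.log P) := by nlinarith
  have hC0 : 0 ≤ max C 0 := le_max_right _ _
  rcases le_or_gt r₁ R with hbig | hsmall
  · -- large radical: use the asymptotic `abc` bound
    have h1 := h1' ((le_max_left _ _).trans hbig)
    have hllR : 1 ≤ Real.log (Real.log R) := one_le_log_log (hr₁16.trans hbig)
    have hlR : 0 < Real.log R := Real.log_pos (by linarith)
    have hRlR : R * Real.log R ≤ P * Real.log P :=
      mul_le_mul hRP (Real.log_le_log (by linarith) hRP) hlR.le (by linarith)
    have hll : Real.log (Real.log R) ≤ Real.log (Real.log P) :=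
      Real.log_le_log hlR (Real.log_le_log (by linarith) hRP)
    have hRll : R * Real.log (Real.log R) ≤ P * Real.log (Real.log P) :=
      mul_le_mul hRP hll (by linarith) (by linarith)
    have hCterm : C * R * Real.log (Real.log R) ≤ max C 0 * (P * Real.log (Real.log P)) := by
      calc C * R * Real.log (Real.log R) ≤ max C 0 * (R * Real.log (Real.log R)) := by
            rw [mul_assoc]
            exact mul_le_mul_of_nonneg_right (le_max_left _ _) (by nlinarith)
        _ ≤ max C 0 * (P * Real.log (Real.log P)) := mul_le_mul_of_nonneg_left hRll hC0
    calc max (logHeight₁ U) (logHeight₁ V) ≤ _ := hmax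
      _ ≤ 4 * R * Real.log R + C * R * Real.log (Real.log R) := h1
      _ ≤ 4 * P * Real.log P + (max C 0 + K₀) * P * Real.log (Real.log P) := by nlinarith
  · -- small radical: the explicit bound is a constant `≤ K₀`
    have h2 := bound_mono hR1 hsmall.le
    calc max (logHeight₁ U) (logHeight₁ V) ≤ _ := hmax
      _ ≤ K₀ := (h2'.trans_le h2).le
      _ ≤ K₀ * (P * Real.log (Real.log P)) := le_mul_of_one_le_right hK₀0 hPllP
      _ ≤ 4 * P * Real.log P + (max C 0 + K₀) * P * Real.log (Real.log P) := by nlinarith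

end MurtyPasten

end Literature.NumberTheory.DiophantineGeometry

end
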